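import Literature.AnabelianGeometry.SemiGraphs.GraphOfAnabelioids

/-!
# Functors into `B(𝒢)` from components, and their isomorphisms ([SemiAnbd] Def. 2.1, p. 23)

Mochizuki, *Semi-graphs of anabelioids*, Publ. RIMS **42** (2006), §2 pp. 22–23
[cite: MochizukiSemiAnbd2006, Def. 2.1 p.23]: the category `B(𝒢)` of a semi-graph of anabelioids
has objects the systems `{S_v, T_e, ψ_b : b^* S_v ⥲ T_e}` and "morphisms in the evident sense".  It
is therefore a lax limit: a functor `K ⥤ B(𝒢)` is the same as functors `K ⥤ 𝒢_v`, `K ⥤ 𝒢_e` to the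
constituents together with natural gluing isomorphisms along the branches, and an isomorphism of two
such functors is a family of natural isomorphisms of the components compatible with the gluings.
This file records that bookkeeping (brick G2 of the global clause `B(𝒢_A) ≃ B(𝒢)_{/A}` of
Def. 2.2 (i), where the comparison functor `B(𝒢)_{/A} ⥤ B(𝒢_A)` and the isomorphism
`φ^* ≅ (A × −) ⋙ α` are built this way):

* `BObj.isoMk` — an isomorphism in `B(𝒢)` from isomorphisms of the components compatible with the
  gluing isomorphisms;
* `BObj.lift` — the functor `K ⥤ B(𝒢)` determined by component functors and natural gluings, with
  `lift ⋙ ρ_v = F_v`, `lift ⋙ ρ_e = F_e` definitionally;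
* `BObj.natIsoOfComponents` — a natural isomorphism `F ≅ G` of functors `K ⥤ B(𝒢)` from natural
  isomorphisms `F ⋙ ρ_v ≅ G ⋙ ρ_v`, `F ⋙ ρ_e ≅ G ⋙ ρ_e` compatible with the gluings.
-/

namespace Literature.AnabelianGeometry.SemiGraphs

namespace SemiGraphOfAnabelioids

open CategoryTheory

universe w' w v₁ u₁ u

variable {𝒢 : SemiGraphOfAnabelioids.{v₁, u₁, u}}

namespace BObj

/-! ### Isomorphisms in `B(𝒢)` from components -/

/-- An isomorphism of `B(𝒢)` from isomorphisms of the vertex and edge objects compatible with the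
gluing isomorphisms ("morphisms in the evident sense", p. 23).
[cite: MochizukiSemiAnbd2006, Def. 2.1 p.23] -/
@[simps]
def isoMk {A B : 𝒢.BObj} (eS : ∀ v, A.S v ≅ B.S v) (eT : ∀ e, A.T e ≅ B.T e)
    (comm : ∀ (b : 𝒢.graph.Branch) (v : 𝒢.graph.Vertex) (h : 𝒢.graph.abuts b = some v),
      (𝒢.pull b v h).pullback.map (eS v).hom ≫ (B.ψ b v h).hom =
        (A.ψ b v h).hom ≫ (eT (𝒢.graph.edgeOf b)).hom) : A ≅ B where
  hom := { fS := fun v => (eS v).hom, fT := fun e => (eT e).hom, comm := comm }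
  inv :=
    { fS := fun v => (eS v).inv
      fT := fun e => (eT e).inv
      comm := fun b v h => by
        rw [← cancel_epi ((𝒢.pull b v h).pullback.map (eS v).hom), ← Functor.map_comp_assoc,
          Iso.hom_inv_id, CategoryTheory.Functor.map_id, Category.id_comp, ← Category.assoc, comm b v h,
          Category.assoc, Iso.hom_inv_id, Category.comp_id] }
  hom_inv_id := by ext <;> simp
  inv_hom_id := by ext <;> simp

/-! ### Functors into `B(𝒢)` from components -/

variable {K : Type w} [Category.{w'} K]

/-- **The functor `K ⥤ B(𝒢)` determined by component functors and natural gluing isomorphisms**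
(`B(𝒢)` as a lax limit of the constituents, p. 23): objects `k ↦ {F_v k, F_e k, (glue_b)_k}`.
[cite: MochizukiSemiAnbd2006, Def. 2.1 p.23] -/
@[simps]
def lift (FV : ∀ v : 𝒢.graph.Vertex, K ⥤ 𝒢.V v) (FE : ∀ e : 𝒢.graph.Edge, K ⥤ 𝒢.E e)
    (glue : ∀ (b : 𝒢.graph.Branch) (v : 𝒢.graph.Vertex) (h : 𝒢.graph.abuts b = some v),
      FV v ⋙ (𝒢.pull b v h).pullback ≅ FE (𝒢.graph.edgeOf b)) : K ⥤ 𝒢.BObj where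
  obj k :=
    { S := fun v => (FV v).obj k
      T := fun e => (FE e).obj k
      ψ := fun b v h => (glue b v h).app k }
  map f :=
    { fS := fun v => (FV v).map f
      fT := fun e => (FE e).map f
      comm := fun b v h => (glue b v h).hom.naturality f }
  map_id k := by ext <;> simp
  map_comp f g := by ext <;> simp

/-- The lifted functor has the prescribed vertex components: `lift ⋙ ρ_v = F_v`.
[cite: MochizukiSemiAnbd2006, Def. 2.1 p.23] -/
theorem lift_comp_ρ (FV : ∀ v : 𝒢.graph.Vertex, K ⥤ 𝒢.V v) (FE : ∀ e : 𝒢.graph.Edge, K ⥤ 𝒢.E e)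
    (glue : ∀ (b : 𝒢.graph.Branch) (v : 𝒢.graph.Vertex) (h : 𝒢.graph.abuts b = some v),
      FV v ⋙ (𝒢.pull b v h).pullback ≅ FE (𝒢.graph.edgeOf b)) (v : 𝒢.graph.Vertex) :
    lift FV FE glue ⋙ 𝒢.ρ v = FV v := rfl

/-- The lifted functor has the prescribed edge components: `lift ⋙ ρ_e = F_e`.
[cite: MochizukiSemiAnbd2006, Def. 2.1 p.23] -/
theorem lift_comp_ρE (FV : ∀ v : 𝒢.graph.Vertex, K ⥤ 𝒢.V v) (FE : ∀ e : 𝒢.graph.Edge, K ⥤ 𝒢.E e)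
    (glue : ∀ (b : 𝒢.graph.Branch) (v : 𝒢.graph.Vertex) (h : 𝒢.graph.abuts b = some v),
      FV v ⋙ (𝒢.pull b v h).pullback ≅ FE (𝒢.graph.edgeOf b)) (e : 𝒢.graph.Edge) :
    lift FV FE glue ⋙ 𝒢.ρE e = FE e := rfl

/-! ### Natural isomorphisms of functors into `B(𝒢)` from components -/

/-- **A natural isomorphism `F ≅ G` of functors `K ⥤ B(𝒢)` from natural isomorphisms of the vertex
and edge components compatible with the gluing isomorphisms** (again "morphisms in the evident
sense", p. 23). [cite: MochizukiSemiAnbd2006, Def. 2.1 p.23] -/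
@[simps!]
def natIsoOfComponents {F G : K ⥤ 𝒢.BObj} (ηV : ∀ v, F ⋙ 𝒢.ρ v ≅ G ⋙ 𝒢.ρ v)
    (ηE : ∀ e, F ⋙ 𝒢.ρE e ≅ G ⋙ 𝒢.ρE e)
    (comm : ∀ (b : 𝒢.graph.Branch) (v : 𝒢.graph.Vertex) (h : 𝒢.graph.abuts b = some v) (k : K),
      (𝒢.pull b v h).pullback.map ((ηV v).hom.app k) ≫ ((G.obj k).ψ b v h).hom =
        ((F.obj k).ψ b v h).hom ≫ (ηE (𝒢.graph.edgeOf b)).hom.app k) : F ≅ G :=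
  NatIso.ofComponents
    (fun k => isoMk (fun v => (ηV v).app k) (fun e => (ηE e).app k) (fun b v h => comm b v h k))
    (fun {k k'} f => by
      ext
      · exact (ηV _).hom.naturality f
      · exact (ηE _).hom.naturality f)

end BObj

end SemiGraphOfAnabelioids

end Literature.AnabelianGeometry.SemiGraphs
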